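import Summits.QuantumFields.YangMills.Theorems.SwapVirialDeficitBlowUpGnomonicLetterFloors
import HarnessLib

/-!
# The full cross-product leader floor `4|x × y|²/((1+|x|²)(1+|y|²)) ≤ 1800L⁶F̂` (every hub)

Sub-problem `SwapVirialDeficit`, crux ⟨stmt-QuantumFields-24197⟩ `SwapGluedStiffness`, skeleton ➎, stub `stub_core_tip`, socket (hCore), step S0 of w3 g68's
(C2-asm) list (STATUS 01:36Z).  ✓`gnoDeficit_floor_yAxial` keeps only the two `e₀`-components of `x × y`; the third, `x₁y₂ − x₂y₁ = |p|²·(τ⃗ × ρ⃗)` in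
joint/relative letters, comes from the same commutator relation `‖x̂ŷ − ŷx̂‖ ≤ 60L³√F̂/√2` (✓`bfar_rel_comm02`):
* `bfar_comm_imI` — the `I`-component of a commutator; `bfar_comm_cross_sq_ge` — `4|x × y|²/((1+|x|²)(1+|y|²)) ≤ ‖x̂ŷ − ŷx̂‖²`;
* ★ `gnoDeficit_floor_cross` — the floor, every hub `a`, every sign pattern, every letter;
* `cross_sq_jointRel` — in joint/relative letters `|x × y|² = (x₀²+y₀²)²·(|ρ⃗|² + (τ⃗×ρ⃗)²)`.
With ✓`tipRot_letters` this makes the K7g group distance of the rotated tip point to its base point small uniformly in the joint tilt.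

HONEST LABEL: helper inequalities only; (hCore), `stub_core_tip`, ⟨24197⟩, ⟨24194⟩ remain OPEN; nothing here proves the Yang–Mills mass gap.
-/

noncomputable section

open MeasureTheory Quaternion
open scoped BigOperators Quaternion
open Literature.MathematicalPhysics.QuantumFieldTheory hiding SU2
open Literature.MathematicalPhysics.QuantumLattice
open Literature.Analysis.Calculus (radialUnit radialUnit_def norm_radialUnit)

namespace Summit.QuantumFields.YangMills.Theorems.SwapVirialDeficit.BlowUpRing

open Summit.QuantumFields.YangMills.Theorems.FemtoTransferGap
open Summit.QuantumFields.YangMills.Theorems.FemtoTransferGap.TT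
open Summit.QuantumFields.YangMills.Theorems.VirialFluxGap.RingDeficit
open Summit.QuantumFields.YangMills.Theorems.SwapVirialDeficit.SwapRing

variable {L : ℕ} [NeZero L]

omit [NeZero L] in
/-- The `I`-component of a commutator: `(XY − YX)_I = 2(X_J Y_K − X_K Y_J)`. [folklore] -/
theorem bfar_comm_imI (X Y : ℍ) : (X * Y - Y * X).imI = 2 * (X.imJ * Y.imK - X.imK * Y.imJ) := by
  simp; ring

omit [NeZero L] in
/-- ★ `4|x × y|²/((1+|x|²)(1+|y|²)) ≤ ‖x̂ŷ − ŷx̂‖²` for the radial units of two gnomonic letters (all three components of the cross product). [folklore] -/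
theorem bfar_comm_cross_sq_ge (εx εy : Bool) (x y : Fin 3 → ℝ) :
    4 * ((x 1 * y 2 - x 2 * y 1) ^ 2 + (x 2 * y 0 - x 0 * y 2) ^ 2 + (x 0 * y 1 - x 1 * y 0) ^ 2) /
        ((1 + ((x 0) ^ 2 + (x 1) ^ 2 + (x 2) ^ 2)) * (1 + ((y 0) ^ 2 + (y 1) ^ 2 + (y 2) ^ 2))) ≤
      ‖radialUnit (gnoLetter εx x) * radialUnit (gnoLetter εy y) - radialUnit (gnoLetter εy y) * radialUnit (gnoLetter εx x)‖ ^ 2 := by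
  rw [bfar_radialUnit_comm, bfar_norm_smul_sq]
  have him := bfar_im_le_norm_sq (gnoLetter εx x * gnoLetter εy y - gnoLetter εy y * gnoLetter εx x)
  have eI := bfar_comm_imI (gnoLetter εx x) (gnoLetter εy y)
  obtain ⟨eJ, eK⟩ := bfar_comm_imJK (gnoLetter εx x) (gnoLetter εy y)
  obtain ⟨-, x1, x2, x3⟩ := bfar_gnoLetter_components εx x
  obtain ⟨-, y1, y2, y3⟩ := bfar_gnoLetter_components εy y
  have hsx : gnoSign εx ^ 2 = 1 := gnoSign_sq εx
  have hsy : gnoSign εy ^ 2 = 1 := gnoSign_sq εy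
  rw [eI, eJ, eK, x1, x2, x3, y1, y2, y3] at him
  have hX := bfar_norm_gnoLetter_sq εx x
  have hY := bfar_norm_gnoLetter_sq εy y
  have hXpos : 0 < 1 + ((x 0) ^ 2 + (x 1) ^ 2 + (x 2) ^ 2) := by positivity
  have hYpos : 0 < 1 + ((y 0) ^ 2 + (y 1) ^ 2 + (y 2) ^ 2) := by positivity
  have key : (2 * (gnoSign εx * x 1 * (gnoSign εy * y 2) - gnoSign εx * x 2 * (gnoSign εy * y 1))) ^ 2 +
      (2 * (gnoSign εx * x 2 * (gnoSign εy * y 0) - gnoSign εx * x 0 * (gnoSign εy * y 2))) ^ 2 +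
      (2 * (gnoSign εx * x 0 * (gnoSign εy * y 1) - gnoSign εx * x 1 * (gnoSign εy * y 0))) ^ 2 =
      4 * ((x 1 * y 2 - x 2 * y 1) ^ 2 + (x 2 * y 0 - x 0 * y 2) ^ 2 + (x 0 * y 1 - x 1 * y 0) ^ 2) := by
    have e0 : (2 * (gnoSign εx * x 1 * (gnoSign εy * y 2) - gnoSign εx * x 2 * (gnoSign εy * y 1))) ^ 2 =
        4 * (gnoSign εx ^ 2 * gnoSign εy ^ 2) * (x 1 * y 2 - x 2 * y 1) ^ 2 := by ring
    have e1 : (2 * (gnoSign εx * x 2 * (gnoSign εy * y 0) - gnoSign εx * x 0 * (gnoSign εy * y 2))) ^ 2 =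
        4 * (gnoSign εx ^ 2 * gnoSign εy ^ 2) * (x 2 * y 0 - x 0 * y 2) ^ 2 := by ring
    have e2 : (2 * (gnoSign εx * x 0 * (gnoSign εy * y 1) - gnoSign εx * x 1 * (gnoSign εy * y 0))) ^ 2 =
        4 * (gnoSign εx ^ 2 * gnoSign εy ^ 2) * (x 0 * y 1 - x 1 * y 0) ^ 2 := by ring
    rw [e0, e1, e2, hsx, hsy]; ring
  rw [key] at him
  rw [mul_pow, inv_pow, inv_pow, hX, hY, div_eq_mul_inv, mul_inv, mul_comm]
  have h0 : 0 ≤ (1 + ((x 0) ^ 2 + (x 1) ^ 2 + (x 2) ^ 2))⁻¹ * (1 + ((y 0) ^ 2 + (y 1) ^ 2 + (y 2) ^ 2))⁻¹ := by positivity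
  exact mul_le_mul_of_nonneg_left him h0

/-- ★★ (x × y) **THE FULL CROSS-PRODUCT FLOOR**: `4|x × y|²/((1+|x|²)(1+|y|²)) ≤ 1800L⁶F̂` — every hub `a`, every sign pattern, every letter. [cite: Luscher1983, §2] -/
theorem gnoDeficit_floor_cross (a : ℍ) (ε : GnoSign L) (η : GnoCoord L) :
    4 * ((η.1.1 1 * η.1.2 2 - η.1.1 2 * η.1.2 1) ^ 2 + (η.1.1 2 * η.1.2 0 - η.1.1 0 * η.1.2 2) ^ 2 + (η.1.1 0 * η.1.2 1 - η.1.1 1 * η.1.2 0) ^ 2) /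
        ((1 + ((η.1.1 0) ^ 2 + (η.1.1 1) ^ 2 + (η.1.1 2) ^ 2)) * (1 + ((η.1.2 0) ^ 2 + (η.1.2 1) ^ 2 + (η.1.2 2) ^ 2))) ≤
      1800 * (L : ℝ) ^ 6 * gnoDeficit (fun _ => false) (fun _ => 1) a ε η :=
  (bfar_comm_cross_sq_ge ε.1.1 ε.1.2 η.1.1 η.1.2).trans (bfar_rel_comm02 a ε η)

omit [NeZero L] in
/-- In joint/relative letters (`u = x₀τ − y₀ρ`, `v = y₀τ + x₀ρ` componentwise, `x = (x₀,u)`, `y = (y₀,v)`):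
`|x × y|² = (x₀²+y₀²)²·(|ρ|² + (τ×ρ)²)`. [folklore] -/
theorem cross_sq_jointRel (x₀ y₀ τ₁ τ₂ ρ₁ ρ₂ : ℝ) :
    ((x₀ * τ₁ - y₀ * ρ₁) * (y₀ * τ₂ + x₀ * ρ₂) - (x₀ * τ₂ - y₀ * ρ₂) * (y₀ * τ₁ + x₀ * ρ₁)) ^ 2 +
        ((x₀ * τ₂ - y₀ * ρ₂) * y₀ - x₀ * (y₀ * τ₂ + x₀ * ρ₂)) ^ 2 + (x₀ * (y₀ * τ₁ + x₀ * ρ₁) - (x₀ * τ₁ - y₀ * ρ₁) * y₀) ^ 2 =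
      (x₀ ^ 2 + y₀ ^ 2) ^ 2 * ((ρ₁ ^ 2 + ρ₂ ^ 2) + (τ₁ * ρ₂ - τ₂ * ρ₁) ^ 2) := by
  ring

end Summit.QuantumFields.YangMills.Theorems.SwapVirialDeficit.BlowUpRing

end
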